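import Summits.ABC.StewartYu.MatveevLeverMinors
import Literature.NumberTheory.Transcendental.PhilipponZeroEstimateMultidegree
import HarnessLib

/-!
# Cell abc-stewartyu, Gen-3 frames (cruxes `Y07Odd`/`Y07Two`): the RECORD's exits A and B reduced to
# two explicit parameter inequalities (the matrix side of Nesterenko's Lemmas 5.3 / 5.4)

`Summits/ABC/StewartYu/RecordExits.lean` — cell `abc-stewartyu` (HOME `run/shared/lean/pub/abc-stewartyu/`),
route `PadicPrimesKummerThird`, seat p4 (g3), engine-support seat.  Theorems only, place-free.

The record predicates `GenThreeFrameSpecTwo.RecordTwo` / `GenThreeFrameSpecOdd.RecordOdd` (clauses (A), (B))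
ask the parameter ledger (p1) to REFUTE, for EVERY `r`, `d₀ ≤ 1` and every `r × n` integer matrix `M`
with independent rows, the zero estimate's exit inequality
`choose(S₀ + ℓ, ℓ) · (2X+1) · nesterenkoH n r d₀ M D₀ D ≤ (n+1)!·2ⁿ·D₀·∏ⱼ Dⱼ`
(`ℓ = r + 1 − d₀` for exit A, `ℓ = n − d₀` with `r = n` for exit B).  The only matrix-dependent
quantity is `nesterenkoH = (d₀+n−r)!·2^{n−r}·D₀^{d₀}·∑_{|I|=r} |det M_I|·∏_{j∉I} Dⱼ`, and — exactly as in
print ("at least one of the coefficients `|det M_{i₁…i_r}|` is a non-zero integer", Nesterenko 2003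
p. 129) — independence of the rows gives a non-zero `r × r` minor `I₀`, hence
`nesterenkoH ≥ (d₀+n−r)!·2^{n−r}·D₀^{d₀}·∏_{j∉I₀} Dⱼ` and, after cancelling `∏_{j∉I₀} Dⱼ ≥ 1`,
the exit inequality implies
`choose(S₀+ℓ, ℓ)·(2X+1)·(d₀+n−r)!·2^{n−r}·D₀^{d₀} ≤ (n+1)!·2ⁿ·D₀·∏_{i∈I₀} Dᵢ ≤ (n+1)!·2ⁿ·D₀·Dmax^r`
(`exit_ineq_minor`, `exit_ineq_pow`).  Consequently the record's clauses follow from PURE PARAMETER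
inequalities, uniformly in `M`:

* `clauseA_of_lt` — clause (A) of `RecordTwo`/`RecordOdd` from
  `∀ r ≤ n, ∀ d₀ ≤ 1, (n+1)!·2ⁿ·D₀·Dmax^r < choose(S₀+(r+1−d₀), r+1−d₀)·(2X+1)·(d₀+n−r)!·2^{n−r}·D₀^{d₀}`
  (print: (5.14)–(5.17) with `Dⱼ ≤ 2^{−n−22}L`);
* `clauseB_of_lt` — clause (B) from `∀ d₀ ≤ 1, (n+1)!·2ⁿ·D₀·∏ Dⱼ < choose(S₀+(n−d₀), n−d₀)·(2X+1)·d₀!·D₀^{d₀}`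
  (print: Lemma 5.4 with (5.18)).

Supporting lemmas: `exists_absMinor_ne_zero` (independent rows ⇒ a non-zero `absMinor`, via p4-g2's
`MatveevLever.sum_minors_pos` / `sum_minors_eq_sum_absMinor`), `term_le_nesterenkoH`.

WHAT THIS IS NOT: no choice of parameters, no numerics (the record's); no crux moves.

References: Yu. V. Nesterenko, LNM 1819 (2003), §5.2: (5.13)–(5.14), Lemma 5.3 (5.15)–(5.17), Lemma 5.4.
-/

open Finset
open Literature.NumberTheory.Transcendental
open Literature.NumberTheory.Transcendental.GaGm

namespace Summit.ABC.StewartYu.RecordExits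

variable {n r : ℕ}

/-- **Independent integer rows have a non-zero `r × r` minor** (in the `absMinor`/`powersetCard`
indexing of `GaGm.nesterenkoH`). [cite: Nesterenko2003, §5.2 p. 129 ("at least one of the coefficients
|det M| is a non-zero integer")] -/
theorem exists_absMinor_ne_zero (M : Matrix (Fin r) (Fin n) ℤ) (hM : LinearIndependent ℤ (fun i => M i)) :
    ∃ I ∈ (univ : Finset (Fin n)).powersetCard r, absMinor M I ≠ 0 := by
  classical
  have hpos := Summit.ABC.StewartYu.MatveevLever.sum_minors_pos (fun _ : Fin n => (1 : ℝ))
    (fun _ => one_pos) (fun i => M i) hM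
  have heq := Summit.ABC.StewartYu.MatveevLever.sum_minors_eq_sum_absMinor M (fun _ : Fin n => (1 : ℝ))
  simp only [Finset.prod_const_one, mul_one] at hpos heq
  rw [heq] at hpos
  obtain ⟨I, hI, hne⟩ := Finset.exists_ne_zero_of_sum_ne_zero hpos.ne'
  exact ⟨I, hI, by exact_mod_cast hne⟩

/-- One term of the minors sum bounds `nesterenkoH` from below: for `|I| = r` with `absMinor M I ≠ 0`,
`(d₀+n−r)!·2^{n−r}·D₀^{d₀}·∏_{j∉I} Dⱼ ≤ nesterenkoH n r d₀ M D₀ D`. [cite: Nesterenko2003, §5.2 (5.13)] -/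
theorem term_le_nesterenkoH (M : Matrix (Fin r) (Fin n) ℤ) (d₀ D₀ : ℕ) (D : Fin n → ℕ)
    {I : Finset (Fin n)} (hI : I ∈ (univ : Finset (Fin n)).powersetCard r) (hne : absMinor M I ≠ 0) :
    (d₀ + (n - r)).factorial * 2 ^ (n - r) * D₀ ^ d₀ * ∏ j ∈ univ \ I, D j ≤
      nesterenkoH n r d₀ M D₀ D := by
  classical
  unfold nesterenkoH
  refine Nat.mul_le_mul_left _ ?_
  calc ∏ j ∈ univ \ I, D j ≤ absMinor M I * ∏ j ∈ univ \ I, D j :=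
        Nat.le_mul_of_pos_left _ (Nat.pos_of_ne_zero hne)
    _ ≤ ∑ J ∈ (univ : Finset (Fin n)).powersetCard r, absMinor M J * ∏ j ∈ univ \ J, D j :=
        Finset.single_le_sum (f := fun J => absMinor M J * ∏ j ∈ univ \ J, D j) (fun J _ => Nat.zero_le _) hI

/-- **The exit inequality forces a parameter inequality on a non-zero minor**: with independent rows and
`Dⱼ ≥ 1`, `choose(S₀+ℓ,ℓ)·(2X+1)·nesterenkoH ≤ (n+1)!·2ⁿ·D₀·∏ Dⱼ` gives some `|I₀| = r` with
`choose(S₀+ℓ,ℓ)·(2X+1)·(d₀+n−r)!·2^{n−r}·D₀^{d₀} ≤ (n+1)!·2ⁿ·D₀·∏_{i∈I₀} Dᵢ`.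
[cite: Nesterenko2003, §5.2 (5.13)–(5.14)] -/
theorem exit_ineq_minor (M : Matrix (Fin r) (Fin n) ℤ) (hM : LinearIndependent ℤ (fun i => M i))
    {D : Fin n → ℕ} (hD1 : ∀ j, 1 ≤ D j) {d₀ D₀ S₀ X ℓ : ℕ}
    (h : Nat.choose (S₀ + ℓ) ℓ * (2 * X + 1) * nesterenkoH n r d₀ M D₀ D ≤
      (n + 1).factorial * 2 ^ n * D₀ * ∏ j, D j) :
    ∃ I₀ ∈ (univ : Finset (Fin n)).powersetCard r,
      Nat.choose (S₀ + ℓ) ℓ * (2 * X + 1) * ((d₀ + (n - r)).factorial * 2 ^ (n - r) * D₀ ^ d₀) ≤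
        (n + 1).factorial * 2 ^ n * D₀ * ∏ i ∈ I₀, D i := by
  classical
  obtain ⟨I₀, hI₀, hne⟩ := exists_absMinor_ne_zero M hM
  refine ⟨I₀, hI₀, ?_⟩
  have hT := term_le_nesterenkoH M d₀ D₀ D hI₀ hne
  -- split `∏ⱼ Dⱼ = ∏_{i∈I₀} Dᵢ · ∏_{j∉I₀} Dⱼ`
  have hsplit : ∏ j, D j = (∏ i ∈ I₀, D i) * ∏ j ∈ univ \ I₀, D j := by
    rw [← Finset.prod_union (Finset.disjoint_sdiff), Finset.union_sdiff_of_subset (Finset.subset_univ _)]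
  have hQ : 0 < ∏ j ∈ univ \ I₀, D j := Finset.prod_pos fun j _ => hD1 j
  have h1 : Nat.choose (S₀ + ℓ) ℓ * (2 * X + 1) *
      ((d₀ + (n - r)).factorial * 2 ^ (n - r) * D₀ ^ d₀) * ∏ j ∈ univ \ I₀, D j ≤
      (n + 1).factorial * 2 ^ n * D₀ * (∏ i ∈ I₀, D i) * ∏ j ∈ univ \ I₀, D j := by
    calc Nat.choose (S₀ + ℓ) ℓ * (2 * X + 1) *
          ((d₀ + (n - r)).factorial * 2 ^ (n - r) * D₀ ^ d₀) * ∏ j ∈ univ \ I₀, D j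
        = Nat.choose (S₀ + ℓ) ℓ * (2 * X + 1) *
          ((d₀ + (n - r)).factorial * 2 ^ (n - r) * D₀ ^ d₀ * ∏ j ∈ univ \ I₀, D j) := by ring
      _ ≤ Nat.choose (S₀ + ℓ) ℓ * (2 * X + 1) * nesterenkoH n r d₀ M D₀ D := Nat.mul_le_mul_left _ hT
      _ ≤ (n + 1).factorial * 2 ^ n * D₀ * ∏ j, D j := h
      _ = (n + 1).factorial * 2 ^ n * D₀ * (∏ i ∈ I₀, D i) * ∏ j ∈ univ \ I₀, D j := by
          rw [hsplit]; ring
  exact Nat.le_of_mul_le_mul_right h1 hQ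

/-- A product over `|I| = r` indices of numbers `≤ Dmax` is `≤ Dmax^r`. [folklore] -/
theorem prod_le_pow_of_mem_powersetCard {D : Fin n → ℕ} {Dmax : ℕ} (hDmax : ∀ j, D j ≤ Dmax)
    {I : Finset (Fin n)} (hI : I ∈ (univ : Finset (Fin n)).powersetCard r) :
    ∏ i ∈ I, D i ≤ Dmax ^ r := by
  have hcard : I.card = r := (Finset.mem_powersetCard.mp hI).2
  calc ∏ i ∈ I, D i ≤ ∏ _i ∈ I, Dmax := Finset.prod_le_prod' fun i _ => hDmax i
    _ = Dmax ^ r := by rw [Finset.prod_const, hcard]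

/-- **The exit inequality with the uniform degree bound**: as `exit_ineq_minor`, with
`∏_{i∈I₀} Dᵢ ≤ Dmax^r`. [cite: Nesterenko2003, §5.2 (5.14), (5.17)] -/
theorem exit_ineq_pow (M : Matrix (Fin r) (Fin n) ℤ) (hM : LinearIndependent ℤ (fun i => M i))
    {D : Fin n → ℕ} (hD1 : ∀ j, 1 ≤ D j) {Dmax : ℕ} (hDmax : ∀ j, D j ≤ Dmax) {d₀ D₀ S₀ X ℓ : ℕ}
    (h : Nat.choose (S₀ + ℓ) ℓ * (2 * X + 1) * nesterenkoH n r d₀ M D₀ D ≤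
      (n + 1).factorial * 2 ^ n * D₀ * ∏ j, D j) :
    Nat.choose (S₀ + ℓ) ℓ * (2 * X + 1) * ((d₀ + (n - r)).factorial * 2 ^ (n - r) * D₀ ^ d₀) ≤
      (n + 1).factorial * 2 ^ n * D₀ * Dmax ^ r := by
  obtain ⟨I₀, hI₀, hle⟩ := exit_ineq_minor M hM hD1 h
  exact hle.trans (Nat.mul_le_mul_left _ (prod_le_pow_of_mem_powersetCard hDmax hI₀))

/-! ### The record's clauses (A) and (B) from parameter inequalities -/

/-- **Clause (A) of `RecordTwo` / `RecordOdd` (exit A impossible) from a parameter inequality**, uniformly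
in the matrix: if `(n+1)!·2ⁿ·D₀·Dmax^r < choose(S₀+(r+1−d₀), r+1−d₀)·(2X+1)·(d₀+n−r)!·2^{n−r}·D₀^{d₀}`
for all `r ≤ n`, `d₀ ≤ 1`, then no `r × n` integer matrix with independent rows satisfies the exit-A
inequality. [cite: Nesterenko2003, Lemma 5.3 (5.14)–(5.17)] -/
theorem clauseA_of_lt {D : Fin n → ℕ} (hD1 : ∀ j, 1 ≤ D j) {Dmax : ℕ} (hDmax : ∀ j, D j ≤ Dmax)
    {D₀ S₀ X : ℕ}
    (hlt : ∀ r d₀ : ℕ, r ≤ n → d₀ ≤ 1 →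
      (n + 1).factorial * 2 ^ n * D₀ * Dmax ^ r <
        Nat.choose (S₀ + (r + 1 - d₀)) (r + 1 - d₀) * (2 * X + 1) *
          ((d₀ + (n - r)).factorial * 2 ^ (n - r) * D₀ ^ d₀)) :
    ∀ (r d₀ : ℕ) (M : Matrix (Fin r) (Fin n) ℤ), r ≤ n → d₀ ≤ 1 →
      LinearIndependent ℤ (fun i => M i) →
      ¬ (Nat.choose (S₀ + (r + 1 - d₀)) (r + 1 - d₀) * (2 * X + 1) * nesterenkoH n r d₀ M D₀ D ≤
          (n + 1).factorial * 2 ^ n * D₀ * ∏ j, D j) := by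
  intro r d₀ M hr hd₀ hM h
  exact absurd (exit_ineq_pow M hM hD1 hDmax h) (not_le.mpr (hlt r d₀ hr hd₀))

/-- **Clause (B) of `RecordTwo` / `RecordOdd` (full rank `r = n` impossible) from a parameter
inequality**, uniformly in the matrix: if
`(n+1)!·2ⁿ·D₀·∏ Dⱼ < choose(S₀+(n−d₀), n−d₀)·(2X+1)·d₀!·D₀^{d₀}` for `d₀ ≤ 1`, then no `n × n` integer
matrix with independent rows satisfies the exit inequality at `r = n`.
[cite: Nesterenko2003, Lemma 5.4] -/
theorem clauseB_of_lt {D : Fin n → ℕ} (hD1 : ∀ j, 1 ≤ D j) {D₀ S₀ X : ℕ}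
    (hlt : ∀ d₀ : ℕ, d₀ ≤ 1 →
      (n + 1).factorial * 2 ^ n * D₀ * ∏ j, D j <
        Nat.choose (S₀ + (n - d₀)) (n - d₀) * (2 * X + 1) * (d₀.factorial * D₀ ^ d₀)) :
    ∀ (d₀ : ℕ) (M : Matrix (Fin n) (Fin n) ℤ), d₀ ≤ 1 → LinearIndependent ℤ (fun i => M i) →
      ¬ (Nat.choose (S₀ + (n - d₀)) (n - d₀) * (2 * X + 1) * nesterenkoH n n d₀ M D₀ D ≤
          (n + 1).factorial * 2 ^ n * D₀ * ∏ j, D j) := by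
  classical
  intro d₀ M hd₀ hM h
  obtain ⟨I₀, hI₀, hle⟩ := exit_ineq_minor M hM hD1 h
  -- `|I₀| = n` forces `I₀ = univ`
  have hI₀u : I₀ = univ :=
    Finset.eq_univ_of_card I₀ (by rw [(Finset.mem_powersetCard.mp hI₀).2, Fintype.card_fin])
  rw [hI₀u, Nat.sub_self, Nat.add_zero, pow_zero, mul_one] at hle
  exact absurd hle (not_le.mpr (hlt d₀ hd₀))

end Summit.ABC.StewartYu.RecordExits
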